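import Mathlib
import Summits.ValiantsHypothesis.ValiantsHypothesis.Theorems.KPlusLogSqLawTropicalBReturns

/-!
# Route «KPlusLogSqLaw», crux `TropicalB` (stmt-ValiantsHypothesis-19771) — DIGITS ARE PAID IN ENTRIES: the upward variation of a class count along a
# chain is at most the number of entries into that class (so an `r`-tooth sawtooth of height `h` needs `r·h` entries = new incidences + returns)

HONEST FRAMING.  Helper file (cell `pub-symmetroid`, seat val-sym-trop-p1 g22, 2026-08-29) `--supports` the crux
`Summit.ValiantsHypothesis.ValiantsHypothesis.Theses.KPlusLogSqLaw.TropicalB` (item `stmt-ValiantsHypothesis-19771`).  Pure ACCOUNTING for sequences of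
terms (no dominance needed), complementing `…TropicalBReturns` (p669495): there the length of a chain is paid in column changes = new incidences +
returns; here the SAWTOOTH of one class count («a digit that resets») is paid in ENTRIES into that class.  Nothing here bounds `TropicalB`, and nothing
bears on `WeakLifting`, DoorA26 / DoorA34, `MatrixDescartes` (stmt-ValiantsHypothesis-18050) or VP ≠ VNP.

* `count_succ_sub_le` — one step: `#{j : class l at t+1} − #{j : class l at t} ≤ #{j : column j ENTERS class l at step t}` (enters = its incidence
  changes and the new class is `l`).
* `upVariation_le_entries` — summed: `Σ_t (cₗ(t+1) − cₗ(t)) ≤ Σ_j #{t : column j enters class l at t}` (truncated subtraction = positive part).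
* `rise_le_upVariation` — a rise over a window is at most the upward variation inside it; hence (`teeth_le_entries`) for pairwise disjoint windows
  `k₁ ≤ k₁' ≤ k₂ ≤ k₂' ≤ …` given by monotone maps, `Σ_i (cₗ(kᵢ') − cₗ(kᵢ)) ≤ #entries into class l ≤ Σ_j #changes_j`.
READING (memo DUAL-LANE-g22 §8): a counting-tight `(m,4)` chain realising three digits of size ≈ m/3 has ≈ m²/9 teeth of height ≈ m/3 in its lowest
class, hence ≈ m³/27 entries into that class, of which at most `m²` are first uses of an incidence: the rest are RETURNS.  [this seat]
-/

set_option linter.dupNamespace false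
set_option autoImplicit false

namespace Summit.ValiantsHypothesis.ValiantsHypothesis.Theorems.KPlusLogSqLaw

open Finset

namespace Returns

variable {m K n : ℕ} (p : Fin (n + 1) → Equiv.Perm (Fin m) × (Fin m → Fin K)) (l : Fin K)

/-- **one step**: the class-`l` count grows by at most the number of columns entering class `l`. [this seat] -/
theorem count_succ_sub_le (t : Fin n) :
    (univ.filter fun j : Fin m => (p t.succ).2 j = l).card - (univ.filter fun j : Fin m => (p t.castSucc).2 j = l).card ≤
      (univ.filter fun j : Fin m =>
        ((p t.castSucc).1 j, (p t.castSucc).2 j) ≠ ((p t.succ).1 j, (p t.succ).2 j) ∧ (p t.succ).2 j = l).card := by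
  classical
  -- new class-l columns ⊆ old class-l columns ∪ entering columns
  have hsub : (univ.filter fun j : Fin m => (p t.succ).2 j = l) ⊆
      (univ.filter fun j : Fin m => (p t.castSucc).2 j = l) ∪
        (univ.filter fun j : Fin m =>
          ((p t.castSucc).1 j, (p t.castSucc).2 j) ≠ ((p t.succ).1 j, (p t.succ).2 j) ∧ (p t.succ).2 j = l) := by
    intro j hj
    rw [mem_filter] at hj
    rw [mem_union, mem_filter, mem_filter]
    by_cases hold : (p t.castSucc).2 j = l
    · exact Or.inl ⟨mem_univ _, hold⟩
    · refine Or.inr ⟨mem_univ _, ?_, hj.2⟩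
      intro heq
      apply hold
      rw [(Prod.mk.inj heq).2, hj.2]
  have := (card_le_card hsub).trans (card_union_le _ _)
  omega

/-- **UPWARD VARIATION ≤ ENTRIES**: summed over the steps of the chain, the positive increments of the class-`l` count are at most the total number
of entries into class `l` (counted per column). [this seat] -/
theorem upVariation_le_entries :
    ∑ t : Fin n, ((univ.filter fun j : Fin m => (p t.succ).2 j = l).card -
        (univ.filter fun j : Fin m => (p t.castSucc).2 j = l).card) ≤
      ∑ j : Fin m, (univ.filter fun t : Fin n =>
        ((p t.castSucc).1 j, (p t.castSucc).2 j) ≠ ((p t.succ).1 j, (p t.succ).2 j) ∧ (p t.succ).2 j = l).card := by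
  classical
  calc ∑ t : Fin n, ((univ.filter fun j : Fin m => (p t.succ).2 j = l).card -
          (univ.filter fun j : Fin m => (p t.castSucc).2 j = l).card)
      ≤ ∑ t : Fin n, (univ.filter fun j : Fin m =>
          ((p t.castSucc).1 j, (p t.castSucc).2 j) ≠ ((p t.succ).1 j, (p t.succ).2 j) ∧ (p t.succ).2 j = l).card :=
        sum_le_sum fun t _ => count_succ_sub_le p l t
    _ = ∑ j : Fin m, (univ.filter fun t : Fin n =>
          ((p t.castSucc).1 j, (p t.castSucc).2 j) ≠ ((p t.succ).1 j, (p t.succ).2 j) ∧ (p t.succ).2 j = l).card := by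
        -- double counting of the pairs (t, j)
        simp only [Finset.card_filter]
        exact Finset.sum_comm

/-! ## Telescoping over windows (pure arithmetic on `ℕ`-indexed counts) -/

/-- telescoping with truncated subtraction: a rise over `[k, k']` is at most the sum of the one-step rises inside. [folklore] -/
theorem sub_le_sum_Ico (c : ℕ → ℕ) {k k' : ℕ} (h : k ≤ k') :
    c k' - c k ≤ ∑ t ∈ Finset.Ico k k', (c (t + 1) - c t) := by
  induction k', h using Nat.le_induction with
  | base => simp
  | succ k' hk ih =>
    rw [Finset.sum_Ico_succ_top hk]
    omega

/-- **TEETH ≤ UPWARD VARIATION**: for windows `a i ≤ b i ≤ a (i+1)` (`i < r`) inside `[0, N]`, the total rise over the windows is at most the total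
upward variation `Σ_{t < N} (c (t+1) − c t)`. [folklore] -/
theorem teeth_le_upVariation (c : ℕ → ℕ) {r N : ℕ} (a b : ℕ → ℕ) (hab : ∀ i, i < r → a i ≤ b i)
    (hba : ∀ i, i + 1 < r → b i ≤ a (i + 1)) (hbN : ∀ i, i < r → b i ≤ N) :
    ∑ i ∈ Finset.range r, (c (b i) - c (a i)) ≤ ∑ t ∈ Finset.range N, (c (t + 1) - c t) := by
  classical
  -- monotonicity of the window endpoints
  have hmono : ∀ i j, i ≤ j → j < r → b i ≤ b j ∧ a i ≤ a j := by
    intro i j hij hj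
    induction j, hij using Nat.le_induction with
    | base => exact ⟨le_rfl, le_rfl⟩
    | succ j hij ih =>
      have hj' : j < r := by omega
      obtain ⟨h1, h2⟩ := ih hj'
      exact ⟨h1.trans ((hba j hj).trans (hab (j + 1) hj)), h2.trans ((hab j hj').trans (hba j hj))⟩
  have hdisj : (↑(Finset.range r) : Set ℕ).PairwiseDisjoint fun i => Finset.Ico (a i) (b i) := by
    intro i hi j hj hij
    simp only [Finset.coe_range, Set.mem_Iio] at hi hj
    simp only [Function.onFun]
    rw [Finset.disjoint_left]
    intro x hxi hxj
    rw [Finset.mem_Ico] at hxi hxj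
    rcases lt_or_gt_of_ne hij with hlt | hlt
    · have : b i ≤ a j := (hba i (by omega)).trans (hmono (i + 1) j (by omega) hj).2
      omega
    · have : b j ≤ a i := (hba j (by omega)).trans (hmono (j + 1) i (by omega) hi).2
      omega
  calc ∑ i ∈ Finset.range r, (c (b i) - c (a i))
      ≤ ∑ i ∈ Finset.range r, ∑ t ∈ Finset.Ico (a i) (b i), (c (t + 1) - c t) :=
        Finset.sum_le_sum fun i hi => sub_le_sum_Ico c (hab i (Finset.mem_range.mp hi))
    _ = ∑ t ∈ (Finset.range r).biUnion (fun i => Finset.Ico (a i) (b i)), (c (t + 1) - c t) :=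
        (Finset.sum_biUnion hdisj).symm
    _ ≤ ∑ t ∈ Finset.range N, (c (t + 1) - c t) := by
        apply Finset.sum_le_sum_of_subset_of_nonneg
        · intro t ht
          rw [Finset.mem_biUnion] at ht
          obtain ⟨i, hi, hti⟩ := ht
          rw [Finset.mem_range] at hi ⊢
          rw [Finset.mem_Ico] at hti
          have := hbN i hi
          omega
        · intro _ _ _; exact Nat.zero_le _

/-- **TEETH ≤ ENTRIES (chain form).**  Along any sequence of `n + 1` terms, with `cₗ(k)` the number of columns of class `l` at time `k` (read through
`ℕ`-indices `< n + 1`): for windows `a i ≤ b i ≤ a (i+1) ≤ … ≤ n`, the total rise `Σ_i (cₗ(b i) − cₗ(a i))` is at most the number of ENTRIES into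
class `l`, itself at most the total number of column changes. [this seat] -/
theorem teeth_le_entries {r : ℕ} (a b : ℕ → ℕ) (hab : ∀ i, i < r → a i ≤ b i)
    (hba : ∀ i, i + 1 < r → b i ≤ a (i + 1)) (hbn : ∀ i, i < r → b i ≤ n) :
    ∑ i ∈ Finset.range r,
        ((univ.filter fun j : Fin m => (p (Fin.ofNat (n + 1) (b i))).2 j = l).card -
          (univ.filter fun j : Fin m => (p (Fin.ofNat (n + 1) (a i))).2 j = l).card) ≤
      ∑ j : Fin m, (univ.filter fun t : Fin n =>
        ((p t.castSucc).1 j, (p t.castSucc).2 j) ≠ ((p t.succ).1 j, (p t.succ).2 j) ∧ (p t.succ).2 j = l).card := by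
  classical
  let c : ℕ → ℕ := fun i => (univ.filter fun j : Fin m => (p (Fin.ofNat (n + 1) i)).2 j = l).card
  have h1 := teeth_le_upVariation c a b hab hba hbn (N := n)
  have h2 := upVariation_le_entries p l
  -- identify the `ℕ`-indexed variation with the `Fin n`-indexed one
  have h3 : ∑ t ∈ Finset.range n, (c (t + 1) - c t) =
      ∑ t : Fin n, ((univ.filter fun j : Fin m => (p t.succ).2 j = l).card -
        (univ.filter fun j : Fin m => (p t.castSucc).2 j = l).card) := by
    rw [← Fin.sum_univ_eq_sum_range]
    refine Finset.sum_congr rfl fun t _ => ?_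
    have e1 : Fin.ofNat (n + 1) ((t : ℕ) + 1) = t.succ := by
      ext; simp [Fin.ofNat, Nat.mod_eq_of_lt (by omega : (t : ℕ) + 1 < n + 1)]
    have e2 : Fin.ofNat (n + 1) (t : ℕ) = t.castSucc := by
      ext; simp [Fin.ofNat, Nat.mod_eq_of_lt (by omega : (t : ℕ) < n + 1)]
    simp only [c, e1, e2]
  calc _ = ∑ i ∈ Finset.range r, (c (b i) - c (a i)) := rfl
    _ ≤ _ := h1
    _ = _ := h3
    _ ≤ _ := h2

end Returns

end Summit.ValiantsHypothesis.ValiantsHypothesis.Theorems.KPlusLogSqLaw
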